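import Summits.QuantumFields.BalabanUV.T4Continuum.Spine.NE1p.DressedSmallFieldTBoxMixedLetterLocal
import Literature.Analysis.Complex.OsgoodSeparate

/-!
# T⁴ programme, spine estimate NE1′ (node O3b/H2) — THE TREE HAS OSGOOD: print states analyticity ONE VARIABLE GROUP AT A TIME («H_k(s(Y₀), B′)
# is an analytic function of s(Y₀), B» p. 6; «we extend the expression in (1.10) analytically with respect to t_□» p. 7); the lineage's JOINT
# hypothesis (W89) follows from CONTINUITY + the separately stated holomorphy — Osgood's lemma, kernel in the TREE's
# `Literature/Analysis/Complex/OsgoodSeparate` — and, independently, from (1.23)'s COMPOSITE structure `E(□₀, (tζ̃_□ + t_□ζ_□)H_k(σ(Y₀),B′))`;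
# and the lineage's two hypothesis classes — W39.1∕W43's `Differentiable(On) ℂ` and W55–W89's `AnalyticOnNhd ℂ` — are ONE class on open polydiscs

Cell `pub-balaban`, sub-cell `t4`, row NE1′ formalisation crew (`t4/formal/NE1p/LEAVES.md` row W90 ∕ DAG N29zzzzy, BOOKED typer R-T147 journal l.23986,
cap 260, X-read X229 — own-initiative DICTIONARY∕CONSISTENCY follower of the unit's W89 «(1.23) IN FULL ON PRINT's ANALYTICITY DOMAIN» (p242876)
under R-T61 (ii)), unit `b2b-balaban-t4-ne1p-formalise-leaf-08` (gen 13).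
ADDITIVE — imports W89 `Spine/NE1p/DressedSmallFieldTBoxMixedLetterLocal` (`tBoxMixedLetter_rep_local`, `norm_tBoxMixedLetter_le`; → W74 «SplitLocal»
`integral_mixedDeriv_cubePt_eq_mixedDiff_local`∕`norm_mixedDiff_le_lemma19`∕`mixedLetter_rep_of_split_local`, W57 `isOpen_polyBall`, W43
`mixedLetter_rep_local`, W39.1 `mixedDiff`∕`μS`∕`wS`∕`σS`, W62 `sS`∕`cubePt`, W55 `enumS`∕`analyticOnNhd_apply`, the substrate's `w₁`∕`circ`, the
template's `mixedDeriv`∕`polydisc`) + the Literature module `Literature/Analysis/Complex/OsgoodSeparate` ([cite: HormanderSCV1973] §2.2 — Osgood's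
lemma `SCV.analyticOnNhd_of_continuousOn_of_separately` and «holomorphic ⇒ analytic» `SCV.analyticOnNhd_iff_differentiableOn`, both PROVED there) —
all BY NAME.  THEOREMS ONLY + two `example`s; 0 `def`, 0 `instance`, 0 `def … : Prop`, 0 cite, 0 sorry, 0 `attribute`; nothing upstream restated.

WHY THIS FILE.  Four headers of the lineage (W55 P1, W57, W70, W74) carry «Mathlib has no Osgood lemma for `ℂⁿ`» — true of MATHLIB, and the
reason W43's `mixedLetter_rep_local` (hypothesis `DifferentiableOn ℂ F` on the open polydisc) and «SplitLocal»'s `mixedLetter_rep_of_split_local`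
(hypothesis `AnalyticOnNhd ℂ F`) were booked as two theorems «(the converse (Osgood) is not in Mathlib)».  The TREE has it:
`Literature/Analysis/Complex/Osgood{,Proofs,Separate}.lean` prove Hörmander's Thm 2.2.1∕2.2.6 (holomorphic ⇒ analytic, finite dimension) and
Osgood's lemma (continuous + separately holomorphic ⇒ holomorphic).  And [Balaban1988RGII] states analyticity one variable group at a time:
p. 6 «Gathering together the above statements and estimates we obtain that H_k(s(Y₀), B′) is an analytic function of s(Y₀), B, for |s(Y₀)| ≤
e^{κ₁} and g_k|B| < ε₁», p. 7 «we extend the expression in (1.10) analytically with respect to t_□ satisfying |t_□|4B₀C₁e^{16κ₁}g_k|B| ≤ ½α₂» —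
LOCI of the audited manuscript (renders pp. 6–7 read as images), TYPE∕CONTEXT only — while W89 read (1.23)'s integrand as JOINTLY analytic in
`(t_□, σ(Y₀))`.  Here the gap between the two readings is closed in kernel, twice:
* §1 **`analyticOnNhd_polyBall_iff_differentiableOn`** (Osgood at W57's `isOpen_polyBall`): ONE hypothesis class on the open polydisc; hence
  «SplitLocal»'s cube-integral FTC and its Lemma-19 bound for `Δ_S` under W43's `DifferentiableOn` hypothesis
  (`integral_mixedDeriv_cubePt_eq_mixedDiff_of_differentiableOn`, `norm_mixedDiff_le_lemma19_of_differentiableOn`), W43's theorem RECOVERING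
  «SplitLocal»'s (`example`), and **`analyticOnNhd_univ_iff_differentiable`**: W39.1's ENTIRE class (`Differentiable ℂ F`) = W55's (`AnalyticOnNhd ℂ F univ`);
* §2 **`analyticOnNhd_of_separately_blocks`**: `E : ℂⁿ⁺¹ → ℂ` CONTINUOUS on `{|t| < R₀} × Π_j{|z_j| < R_{j+1}}`, holomorphic in `t_□` at every fixed
  cube configuration (p. 7's statement, TYPE) and jointly analytic in the cubes at every fixed `t_□` (p. 6's, TYPE) ⇒ JOINTLY analytic — the TREE's
  Osgood lemma BY NAME after the slice bookkeeping `update_zero_eq_cons`∕`update_succ_eq_cons` (`Fin.update_cons_zero`∕`Fin.cons_update`);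
  `analyticOnNhd_polyBall_of_separately` (every single coordinate separately);
* §3 **`analyticOnNhd_comp_pencil`**: the COMPOSITE route — for a complex Banach space `G` (field configurations, TYPE), `Ψ : G → ℂ` analytic on an
  open `V` («E(□₀,·)», Sect. I.3, TYPE) and field-valued `a, b : ℂⁿ → G` analytic on the cube polydisc (`tζ̃_□H_k(σ(Y₀),B′)`, `ζ_□H_k(σ(Y₀),B′)`, TYPE)
  with the pencil `a σ + t_□ • b σ ∈ V`: `Ψ(a σ + t_□ • b σ)` is JOINTLY analytic (Mathlib `AnalyticOnNhd.comp`∕`.add`∕`.smul`) — continuity and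
  both separate analyticities come for free on print's composite;
* §4 W89 under either reading: **`tBoxMixedLetter_rep_separately`**, **`norm_tBoxMixedLetter_le_separately`** (continuity + separate holomorphy),
  **`tBoxMixedLetter_rep_pencil`** (the composite; `Fin.tail_cons`∕`Fin.cons_zero`);
* §5 decided: the pencil `e^{z₀z₁ + t_□}` (`Ψ = exp` entire, `a = z₀z₁`, `b ≡ 1`) is jointly analytic on every open polydisc by §3 alone.

HONEST FRAMING.  [folklore] several-complex-variables bookkeeping on OUR dictionary objects: the TREE's Osgood lemma and «holomorphic ⇒ analytic»
([cite: HormanderSCV1973], PROVED in `Literature/Analysis/Complex/`) BY NAME + Mathlib's analytic-composition API; a DICTIONARY∕CONSISTENCY row —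
which analyticity hypothesis the lineage's (1.23)∕(2.14) letters need and how print's sentence-by-sentence statements supply it; NOT an estimate of
print: `E`∕`Ψ`∕`a`∕`b`∕`G` ↔ print's E(□₀,·), H_k, ζ̃_□, ζ_□, configurations are TYPE READINGS; CONTINUITY of the composite is an added READING
(automatic on §3's composite; without it the statement is Hartogs' theorem, NOT in the tree and NOT claimed); no numeral of [Balaban1988RGII]
asserted (k2); (B1) for Bałaban's (2.14) NOT discharged; (B3) = GAPS G-ne9p2-5 UNPRINTED — NOT discharged, untouched; (B5) untouched; 0 binders
instantiated on Bałaban's densities ∕ operators ∕ (2.14) data ∕ `d_k` ∕ minimisers ∕ backgrounds; discharges no wall item; wall v1.8 (T4-DAG v48)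
does NOT move; R-t4r2-Q2 NOT met thereby; NE1′ ⇐ the named binders — NOT proved, NOT printed; spine PROVED 0∕9; count 9 unchanged.  Rung (B)+1
on ONE finite four-torus — NOT infinite volume, NOT a mass gap, NOT OS on ℝ⁴, NOT Clay.  ABSOLUTE RULE honoured: the quotations are LOCI of the
audited manuscript [Balaban1988RGII] (CMP 116 (1988) 1–22, pp. 6–7), TYPE∕CONTEXT only, never hypothesis-free facts; [HormanderSCV1973] enters
only through the cite-tagged, PROVED Literature module BY NAME; nothing internally minted is cited; [folklore] tags on kernel lemmas only.  HONEST
DEPENDENCY: continuum YM on T⁴ ⇐ BetaPertH ∧ nine spine estimates (0/9 proved); BetaPertH ⇐ (D1) ∧ (D4) ∧ CAP+tail; G-an2-4 gates asym, D1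
and NE2/3/4.
-/

noncomputable section

namespace Summit.QuantumFields.BalabanUV.T4Continuum.NE1p.DressedSmallFieldOsgoodBridge

open MeasureTheory Metric Set Complex Finset Function
open scoped BigOperators
open Summit.QuantumFields.BalabanUV.T4Continuum.B13TermContours
open Summit.QuantumFields.BalabanUV.T4Continuum.NE1p.DressedSmallFieldMixedLetter
open Summit.QuantumFields.BalabanUV.T4Continuum.NE1p.DressedSmallFieldMixedDerivativeBridge
open Summit.QuantumFields.BalabanUV.T4Continuum.NE1p.DressedSmallFieldMixedDerivativeFTC (sS cubePt)
open Summit.QuantumFields.BalabanUV.T4Continuum.NE1p.DressedSmallFieldMixedDerivativeLetterLocal (isOpen_polyBall analyticOnNhd_cons_section_local)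
open Summit.QuantumFields.BalabanUV.T4Continuum.NE1p.DressedSmallFieldMixedLetterLocal (mixedLetter_rep_local mapsTo_cons_right)
open Summit.QuantumFields.BalabanUV.T4Continuum.NE1p.DressedSmallFieldMixedDerivativeSplitLocal
open Summit.QuantumFields.BalabanUV.T4Continuum.NE1p.DressedSmallFieldTBoxMixedLetterLocal
open Literature.MathematicalPhysics.QuantumFieldTheory.Dimock2011to13.PolydiscCauchyBounds (mixedDeriv polydisc)
open Literature.Analysis.Complex.SCV (analyticOnNhd_of_continuousOn_of_separately)

variable {n : ℕ}

/-! ## §1 ONE HYPOTHESIS CLASS on the open polydisc: W39.1∕W43's `DifferentiableOn ℂ` letters and W55–W89's `AnalyticOnNhd ℂ` letters -/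

/-- **OSGOOD ON THE OPEN POLYDISC** (the TREE's `Literature.Analysis.Complex.SCV.analyticOnNhd_iff_differentiableOn`, [HormanderSCV1973] Thms
2.2.1∕2.2.6, BY NAME at W57's `isOpen_polyBall`): `F : ℂⁿ → ℂ` is jointly analytic on `Π_j {|z_j| < R_j}` iff it is complex (Fréchet-)differentiable
there — the hypothesis of W43's `mixedLetter_rep_local` and that of «SplitLocal»'s `mixedLetter_rep_of_split_local` are the SAME hypothesis (the
lineage's headers «Mathlib has no Osgood lemma for ℂⁿ» stand for MATHLIB; the TREE has it). [folklore] -/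
theorem analyticOnNhd_polyBall_iff_differentiableOn (R : Fin n → ℝ) {F : (Fin n → ℂ) → ℂ} :
    AnalyticOnNhd ℂ F (Set.univ.pi fun j => ball (0 : ℂ) (R j)) ↔ DifferentiableOn ℂ F (Set.univ.pi fun j => ball (0 : ℂ) (R j)) :=
  Literature.Analysis.Complex.SCV.analyticOnNhd_iff_differentiableOn (isOpen_polyBall R)

/-- **THE ENTIRE CLASS** [folklore] (the `iff` at `univ`): W39.1's hypothesis `Differentiable ℂ F` (`mixedLetter_rep`) and W55's `AnalyticOnNhd ℂ F
univ` (`mixedDerivLetter_rep`) are ONE class. -/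
theorem analyticOnNhd_univ_iff_differentiable {F : (Fin n → ℂ) → ℂ} : AnalyticOnNhd ℂ F univ ↔ Differentiable ℂ F := by
  rw [Literature.Analysis.Complex.SCV.analyticOnNhd_iff_differentiableOn isOpen_univ, differentiableOn_univ]

/-- **«SplitLocal»'s FTC UNDER W43's HYPOTHESIS** [folklore]: `∫ ∂_{enumS S} F (cubePt S s) d(⨂ sS S) = Δ_S F` for `F` merely ℂ-DIFFERENTIABLE on the
open polydisc of radii `> 1` (W43 has no cube-integral theorem; «SplitLocal» stated it for `F` analytic — one class). -/
theorem integral_mixedDeriv_cubePt_eq_mixedDiff_of_differentiableOn {R : Fin n → ℝ} (hR1 : ∀ j, 1 < R j) (S : Finset (Fin n))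
    (F : (Fin n → ℂ) → ℂ) (hF : DifferentiableOn ℂ F (Set.univ.pi fun j => ball (0 : ℂ) (R j))) :
    ∫ s, mixedDeriv (enumS n S) F (cubePt S s) ∂(Measure.pi (sS S)) = mixedDiff n S F :=
  integral_mixedDeriv_cubePt_eq_mixedDiff_local n R S F hR1 ((analyticOnNhd_polyBall_iff_differentiableOn R).2 hF)

/-- **DIMOCK's LEMMA 19 BOUND FOR `Δ_S` UNDER W43's HYPOTHESIS** [folklore]: `‖Δ_S F‖ ≤ A·e^{−(κ₁−1)·#S}` for `F` ℂ-differentiable on an open polydisc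
of radii `> e^{κ₁}` and bounded by `A` on `|z_j| ≤ e^{κ₁}` («SplitLocal» `norm_mixedDiff_le_lemma19` through Osgood). -/
theorem norm_mixedDiff_le_lemma19_of_differentiableOn {R : Fin n → ℝ} {κ₁ A : ℝ} (hκ : 1 ≤ κ₁) (hR : ∀ j, Real.exp κ₁ < R j)
    (S : Finset (Fin n)) {F : (Fin n → ℂ) → ℂ} (hF : DifferentiableOn ℂ F (Set.univ.pi fun j => ball (0 : ℂ) (R j)))
    (hA : ∀ z ∈ polydisc (fun _ : Fin n => Real.exp κ₁), ‖F z‖ ≤ A) :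
    ‖mixedDiff n S F‖ ≤ A * Real.exp (-((κ₁ - 1) * S.card)) :=
  norm_mixedDiff_le_lemma19 hκ hR S ((analyticOnNhd_polyBall_iff_differentiableOn R).2 hF) hA

/-- [folklore] CENSUS: W43's `mixedLetter_rep_local` (hypothesis `DifferentiableOn`) and «SplitLocal»'s `mixedLetter_rep_of_split_local` (hypothesis
`AnalyticOnNhd`) are ONE theorem — each is recovered from the other through the `iff` (here: «SplitLocal»'s from W43's). -/
example {r R : Fin n → ℝ} (hr : ∀ j, 1 < r j) (hR : ∀ j, r j < R j) (S : Finset (Fin n)) (F : (Fin n → ℂ) → ℂ)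
    (hF : AnalyticOnNhd ℂ F (Set.univ.pi fun j => ball (0 : ℂ) (R j))) :
    ∫ p, wS r S p * F (σS r S p) ∂(Measure.pi (μS S)) = mixedDiff n S F :=
  mixedLetter_rep_local n r R S F hr hR ((analyticOnNhd_polyBall_iff_differentiableOn R).1 hF)

/-! ## §2 PRINT STATES ANALYTICITY ONE VARIABLE GROUP AT A TIME: continuity + separate holomorphy ⇒ the joint hypothesis (Osgood) -/

/-- [folklore] Updating coordinate `0` of `z ∈ ℂⁿ⁺¹` is `Fin.cons` over the tail. -/
theorem update_zero_eq_cons (z : Fin (n + 1) → ℂ) (t : ℂ) : update z 0 t = Fin.cons t (Fin.tail z) := by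
  conv_lhs => rw [← Fin.cons_self_tail z]
  exact Fin.update_cons_zero _ _ _

/-- [folklore] Updating a tail coordinate of `z ∈ ℂⁿ⁺¹` is `Fin.cons (z 0)` over the updated tail (Mathlib `Fin.cons_update`). -/
theorem update_succ_eq_cons (z : Fin (n + 1) → ℂ) (k : Fin n) (t : ℂ) :
    update z k.succ t = Fin.cons (z 0) (update (Fin.tail z) k t) := by
  conv_lhs => rw [← Fin.cons_self_tail z]
  exact (Fin.cons_update (z 0) (Fin.tail z) k t).symm

/-- **OSGOOD FOR THE `t_□` ∕ `σ(Y₀)` BLOCKS** (the TREE's `analyticOnNhd_of_continuousOn_of_separately`, [HormanderSCV1973] §2.2 Osgood's lemma, BY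
NAME): if `E : ℂⁿ⁺¹ → ℂ` is CONTINUOUS on the open polydisc `{|t| < R₀} × Π_j{|z_j| < R_{j+1}}`, holomorphic in the `t_□`-variable for every fixed
cube configuration («we extend the expression in (1.10) analytically with respect to t_□», p. 7 — TYPE) and jointly analytic in the cube
variables for every fixed `t_□` («an analytic function of s(Y₀), B, for |s(Y₀)| ≤ e^{κ₁}», p. 6 — TYPE), then `E` is JOINTLY analytic there —
the hypothesis of W89's `tBoxMixedLetter_rep_local`.  Without continuity this would be Hartogs' theorem (NOT in the tree, not claimed). [folklore] -/
theorem analyticOnNhd_of_separately_blocks {R : Fin (n + 1) → ℝ} {E : (Fin (n + 1) → ℂ) → ℂ}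
    (hc : ContinuousOn E (Set.univ.pi fun j => ball (0 : ℂ) (R j)))
    (ht : ∀ w ∈ Set.univ.pi (fun j => ball (0 : ℂ) (Fin.tail R j)), DifferentiableOn ℂ (fun t : ℂ => E (Fin.cons t w)) (ball (0 : ℂ) (R 0)))
    (hs : ∀ t ∈ ball (0 : ℂ) (R 0), AnalyticOnNhd ℂ (fun w : Fin n → ℂ => E (Fin.cons t w)) (Set.univ.pi fun j => ball (0 : ℂ) (Fin.tail R j))) :
    AnalyticOnNhd ℂ E (Set.univ.pi fun j => ball (0 : ℂ) (R j)) := by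
  refine analyticOnNhd_of_continuousOn_of_separately (isOpen_polyBall R) hc fun z hz i => ?_
  have hz' := Set.mem_univ_pi.1 hz
  have h0 : z 0 ∈ ball (0 : ℂ) (R 0) := hz' 0
  have htail : Fin.tail z ∈ Set.univ.pi fun j => ball (0 : ℂ) (Fin.tail R j) := Set.mem_univ_pi.2 fun j => hz' j.succ
  induction i using Fin.cases with
  | zero =>
      have hfun : (fun t : ℂ => E (update z 0 t)) = fun t => E (Fin.cons t (Fin.tail z)) := by
        funext t; rw [update_zero_eq_cons]
      rw [hfun]
      exact (ht _ htail _ h0).differentiableAt (isOpen_ball.mem_nhds h0)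
  | succ k =>
      have hfun : (fun t : ℂ => E (update z k.succ t)) = (fun w : Fin n → ℂ => E (Fin.cons (z 0) w)) ∘ fun t => update (Fin.tail z) k t := by
        funext t; simp only [Function.comp_apply, update_succ_eq_cons]
      rw [hfun]
      refine DifferentiableAt.comp _ ?_ (hasDerivAt_update (Fin.tail z) k _).differentiableAt
      rw [show update (Fin.tail z) k (z k.succ) = Fin.tail z from update_eq_self k (Fin.tail z)]
      exact ((hs _ h0) _ htail).differentiableAt

/-- **OSGOOD, EVERY COORDINATE SEPARATELY** (the TREE's lemma at W57's `isOpen_polyBall`, BY NAME): continuous on the open polydisc and holomorphic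
in EACH single variable at every point ⇒ jointly analytic. [folklore] -/
theorem analyticOnNhd_polyBall_of_separately {R : Fin n → ℝ} {F : (Fin n → ℂ) → ℂ}
    (hc : ContinuousOn F (Set.univ.pi fun j => ball (0 : ℂ) (R j)))
    (hs : ∀ z ∈ Set.univ.pi (fun j => ball (0 : ℂ) (R j)), ∀ i : Fin n, DifferentiableAt ℂ (fun t : ℂ => F (update z i t)) (z i)) :
    AnalyticOnNhd ℂ F (Set.univ.pi fun j => ball (0 : ℂ) (R j)) :=
  analyticOnNhd_of_continuousOn_of_separately (isOpen_polyBall R) hc hs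

/-! ## §3 (1.23)'s COMPOSITE STRUCTURE gives the joint hypothesis directly: `E(□₀, ·)` analytic ∘ the `t_□`-pencil of analytic field maps -/

/-- **THE PENCIL COMPOSITE IS JOINTLY ANALYTIC** [folklore] (Mathlib `AnalyticOnNhd.comp` ∕ `.add` ∕ `.smul`): for a complex Banach space `G` (the
field configurations — TYPE), `Ψ : G → ℂ` analytic on an open `V` («E(□₀, ·) is an analytic function of configurations», Sect. I.3 — TYPE), field-valued
maps `a, b : ℂⁿ → G` analytic on the cube polydisc (`tζ̃_□H_k(σ(Y₀),B′)` and `ζ_□H_k(σ(Y₀),B′)` — TYPE) whose pencil `a(σ) + t_□·b(σ)` stays in `V`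
for `|t_□| < R₀`: `E(t_□ ∷ σ) := Ψ(a σ + t_□ • b σ)` is JOINTLY analytic on `{|t_□| < R₀} × Π_j{|σ_j| < R_{j+1}}` — continuity and BOTH separate
analyticities of §2 come for free. -/
theorem analyticOnNhd_comp_pencil {G : Type*} [NormedAddCommGroup G] [NormedSpace ℂ G] {V : Set G} {Ψ : G → ℂ} (hΨ : AnalyticOnNhd ℂ Ψ V)
    {R : Fin (n + 1) → ℝ} {a b : (Fin n → ℂ) → G} (ha : AnalyticOnNhd ℂ a (Set.univ.pi fun j => ball (0 : ℂ) (Fin.tail R j)))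
    (hb : AnalyticOnNhd ℂ b (Set.univ.pi fun j => ball (0 : ℂ) (Fin.tail R j)))
    (hV : ∀ t ∈ ball (0 : ℂ) (R 0), ∀ w ∈ Set.univ.pi (fun j => ball (0 : ℂ) (Fin.tail R j)), a w + t • b w ∈ V) :
    AnalyticOnNhd ℂ (fun v : Fin (n + 1) → ℂ => Ψ (a (Fin.tail v) + v 0 • b (Fin.tail v))) (Set.univ.pi fun j => ball (0 : ℂ) (R j)) := by
  have htl : AnalyticOnNhd ℂ (fun v : Fin (n + 1) → ℂ => Fin.tail v) (Set.univ.pi fun j => ball (0 : ℂ) (R j)) :=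
    AnalyticOnNhd.pi fun j => (analyticOnNhd_apply (n := n + 1) j.succ).mono (subset_univ _)
  have hmaps : MapsTo (fun v : Fin (n + 1) → ℂ => Fin.tail v) (Set.univ.pi fun j => ball (0 : ℂ) (R j))
      (Set.univ.pi fun j => ball (0 : ℂ) (Fin.tail R j)) := fun v hv => Set.mem_univ_pi.2 fun j => (Set.mem_univ_pi.1 hv) j.succ
  have hin : AnalyticOnNhd ℂ (fun v : Fin (n + 1) → ℂ => a (Fin.tail v) + v 0 • b (Fin.tail v)) (Set.univ.pi fun j => ball (0 : ℂ) (R j)) :=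
    (ha.comp htl hmaps).add (((analyticOnNhd_apply (n := n + 1) 0).mono (subset_univ _)).smul (hb.comp htl hmaps))
  exact hΨ.comp hin fun v hv => hV _ ((Set.mem_univ_pi.1 hv) 0) _ (hmaps hv)

/-! ## §4 W89 UNDER PRINT's SEPARATELY-STATED HYPOTHESES -/

/-- **(1.23) IN FULL UNDER CONTINUITY + SEPARATE HOLOMORPHY** [folklore] (§2 + W89 `tBoxMixedLetter_rep_local`): for the `t_□`-radius `0 < ρ < R₀`,
cube contour radii `1 < r_j < R_{j+1}`, `E` continuous on the open polydisc, holomorphic in `t_□` at fixed cubes and analytic in the cubes at fixed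
`t_□`: `∫_{θ_□} w₁ ρ (0,θ_□)·(∫ wS r S p·E(circ ρ θ_□ ∷ σ_S p) d(⨂ μS S)) dθ_□ = ∂∕∂t|₀ Δ_S E(t ∷ ·)`. -/
theorem tBoxMixedLetter_rep_separately {ρ : ℝ} (hρ : 0 < ρ) {r : Fin n → ℝ} {R : Fin (n + 1) → ℝ} (hρR : ρ < R 0)
    (hr : ∀ j, 1 < r j) (hrR : ∀ j : Fin n, r j < R j.succ) (S : Finset (Fin n)) {E : (Fin (n + 1) → ℂ) → ℂ}
    (hc : ContinuousOn E (Set.univ.pi fun j => ball (0 : ℂ) (R j)))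
    (ht : ∀ w ∈ Set.univ.pi (fun j => ball (0 : ℂ) (Fin.tail R j)), DifferentiableOn ℂ (fun t : ℂ => E (Fin.cons t w)) (ball (0 : ℂ) (R 0)))
    (hs : ∀ t ∈ ball (0 : ℂ) (R 0), AnalyticOnNhd ℂ (fun w : Fin n → ℂ => E (Fin.cons t w)) (Set.univ.pi fun j => ball (0 : ℂ) (Fin.tail R j))) :
    ∫ θ₀ in Icc 0 (2 * Real.pi), w₁ ρ (0, θ₀) *
        ∫ p, wS r S p * E (Fin.cons (circ ρ θ₀) (σS r S p)) ∂(Measure.pi (μS S)) =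
      deriv (fun t : ℂ => mixedDiff n S (fun w => E (Fin.cons t w))) 0 :=
  tBoxMixedLetter_rep_local hρ hρR hr hrR S (analyticOnNhd_of_separately_blocks hc ht hs)

/-- **(1.24)'s SHAPE UNDER CONTINUITY + SEPARATE HOLOMORPHY** [folklore] (§2 + W89 `norm_tBoxMixedLetter_le`). -/
theorem norm_tBoxMixedLetter_le_separately {ρ : ℝ} (hρ : 0 < ρ) {r : Fin n → ℝ} {R : Fin (n + 1) → ℝ} (hρR : ρ < R 0) (hr : ∀ j, 1 < r j)
    (hrR : ∀ j : Fin n, r j < R j.succ) {κ₁ A : ℝ} (hκ : 1 ≤ κ₁) (hR : ∀ j : Fin n, Real.exp κ₁ < R j.succ) (S : Finset (Fin n))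
    {E : (Fin (n + 1) → ℂ) → ℂ} (hc : ContinuousOn E (Set.univ.pi fun j => ball (0 : ℂ) (R j)))
    (ht : ∀ w ∈ Set.univ.pi (fun j => ball (0 : ℂ) (Fin.tail R j)), DifferentiableOn ℂ (fun t : ℂ => E (Fin.cons t w)) (ball (0 : ℂ) (R 0)))
    (hs : ∀ t ∈ ball (0 : ℂ) (R 0), AnalyticOnNhd ℂ (fun w : Fin n → ℂ => E (Fin.cons t w)) (Set.univ.pi fun j => ball (0 : ℂ) (Fin.tail R j)))
    (hA : ∀ t : ℂ, ‖t‖ = ρ → ∀ z ∈ polydisc (fun _ : Fin n => Real.exp κ₁), ‖E (Fin.cons t z)‖ ≤ A) :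
    ‖∫ θ₀ in Icc 0 (2 * Real.pi), w₁ ρ (0, θ₀) *
        ∫ p, wS r S p * E (Fin.cons (circ ρ θ₀) (σS r S p)) ∂(Measure.pi (μS S))‖ ≤
      ρ⁻¹ * (A * Real.exp (-((κ₁ - 1) * S.card))) :=
  norm_tBoxMixedLetter_le hρ hρR hr hrR hκ hR S (analyticOnNhd_of_separately_blocks hc ht hs) hA

/-- **(1.23) IN FULL FOR THE PENCIL COMPOSITE** [folklore] (§3 + W89): print's integrand `Ψ(a σ + t_□ • b σ)` needs NO analyticity hypothesis beyond
those of its three constituents. -/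
theorem tBoxMixedLetter_rep_pencil {G : Type*} [NormedAddCommGroup G] [NormedSpace ℂ G] {V : Set G} {Ψ : G → ℂ} (hΨ : AnalyticOnNhd ℂ Ψ V)
    {ρ : ℝ} (hρ : 0 < ρ) {r : Fin n → ℝ} {R : Fin (n + 1) → ℝ} (hρR : ρ < R 0) (hr : ∀ j, 1 < r j) (hrR : ∀ j : Fin n, r j < R j.succ)
    (S : Finset (Fin n)) {a b : (Fin n → ℂ) → G} (ha : AnalyticOnNhd ℂ a (Set.univ.pi fun j => ball (0 : ℂ) (Fin.tail R j)))
    (hb : AnalyticOnNhd ℂ b (Set.univ.pi fun j => ball (0 : ℂ) (Fin.tail R j)))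
    (hV : ∀ t ∈ ball (0 : ℂ) (R 0), ∀ w ∈ Set.univ.pi (fun j => ball (0 : ℂ) (Fin.tail R j)), a w + t • b w ∈ V) :
    ∫ θ₀ in Icc 0 (2 * Real.pi), w₁ ρ (0, θ₀) *
        ∫ p, wS r S p * Ψ (a (σS r S p) + circ ρ θ₀ • b (σS r S p)) ∂(Measure.pi (μS S)) =
      deriv (fun t : ℂ => mixedDiff n S (fun w => Ψ (a w + t • b w))) 0 := by
  have h := tBoxMixedLetter_rep_local hρ hρR hr hrR S (analyticOnNhd_comp_pencil hΨ ha hb hV)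
  simpa only [Fin.tail_cons, Fin.cons_zero] using h

/-! ## §5 Decided checks -/

/-- DECIDED CHECK (§3's pencil, `G = ℂ`): `Ψ = exp` (entire), `a(z) = z₀z₁`, `b ≡ 1` — `E = e^{z₀z₁ + t}` is jointly analytic on every open
polydisc, with no joint-analyticity argument spelled out. -/
example (R : Fin 3 → ℝ) :
    AnalyticOnNhd ℂ (fun v : Fin 3 → ℂ => Complex.exp (Fin.tail v 0 * Fin.tail v 1 + v 0 • (1 : ℂ))) (Set.univ.pi fun j => ball (0 : ℂ) (R j)) :=
  analyticOnNhd_comp_pencil analyticOnNhd_cexp (((analyticOnNhd_apply 0).mul (analyticOnNhd_apply 1)).mono (subset_univ _))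
    (analyticOnNhd_const.mono (subset_univ _)) fun _ _ _ _ => mem_univ _

end Summit.QuantumFields.BalabanUV.T4Continuum.NE1p.DressedSmallFieldOsgoodBridge

end
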